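import Literature.MathematicalPhysics.QuantumFieldTheory.Balaban1983to89.B1Eq324BenfattoSect5PavementChain
import HarnessLib

/-!
# `Balaban1983to89.B1Eq324BenfattoSect5CollectErrors` — [BenfattoEtAl1978] §5 p. 159, «Collecting all the errors made in this process (4.7) is proven»:
# (4.7) FOR ONE CHOICE OF EVERYTHING, ASSEMBLED from the lower pavement chain, MODULO the two displayed obligations that remain —
# the per-step IDENTIFICATION of the extracted exponents with the free-cumulant differences, and the ERROR LEDGER against `|I|·S(…)`

statement-level skeleton of published theorems with citation tags; proofs where landed; nothing here is a claim about the
Yang–Mills mass gap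

WHY THIS MODULE (cell `pub-ymgap`, seat `dag-n08-c` gen 19, INTENT-3; node N08 [Balaban1985UV3]; sequel of `B1Eq324BenfattoSect5PavementChain`).
The typed target `B1Eq324BenfattoLemma.Ineq47` reads `exp([Σ_{k=1}^{t}ℰ̂₀^T(H_J;k)/k!] − |I|·S(…)) ≤ ∫Π_Δχ̂_Δ e^{H_J} dP̂₀`.  The lower chain
(`…PavementChain.lowerPavementChain_appendixA`) delivers `exp(Σ_{k≤d}(−err₅₁₁(k) − err₅₃₄(k) + Σ_{□∈B_k}ℓ_k(□)) − |I|·k₁e^{−k₂b_{d+1}²}) ≤ ∫Π_Δχ̂_Δ e^{H_J} dP̂₀`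
for any per-box exponents `ℓ_k(□)` the per-box line supplies, and the free cumulants telescope across the drifting frames
(`…PavementChain.cumulantSum_chain_telescope_of_eq_empty`).  What is left between the two is print's last sentence: (O1) at every step the
extracted exponents dominate the free-cumulant difference «current Hamiltonian minus handed-on Hamiltonian» up to a loss `idErr_k` (the sibling
seat dag-n08-b's `…Sect5FreeStep.sum_truncatedExp_sub_eq_telescope` + the CROSS / `Ψ₃` / (5.34) / (5.11) bounds: `…FreeStepCross(Masses)`,
`…FreePerturb`, `…HlCumulants`, and the per-box `Err` of `…PerBoxAppD.perBox_condField_appD`), and (O2) the LEDGER: all losses together are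
`≤ |I|·errTerm S ρ₁ ρ₂ ρ₃ ρ₄ A b t` for print's choice of the corridor widths and `b > b*`.  This file proves `Ineq47` from the chain hypotheses
PLUS (O1) and (O2) as displayed hypotheses — so the two remaining obligations of (4.7) are pinned in their exact Lean shapes.

DICTIONARY.  As in `…PavementChain`; `A ≡ coefSup s D a J` (the `A` of `errTerm` in `Ineq47`); the chain runs on a clipped twin `A_0` of the
coefficient family `a` (`…PavementChain.exists_coefSupportedIn_clip`: same Hamiltonians on the sub-regions of `J`, extension convention, global bound
`≤ A`), which is why the hypotheses speak of `as 0` and `hH`.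

WHAT IS PROVED (theorems only; no definition, no named fact, no `sorry`; axioms standard).
* `cumulantSum_congr_hamiltonian` (the bracket of (4.7) only reads the Hamiltonian as a function), ★★★ `ineq47_of_chain` — **(4.7) for one choice of
  everything** from: the lower-chain hypotheses of `lowerPavementChain_appendixA` at `n = d + 1` for data starting at `(J, I, A_0, b)`, the identification
  bounds (O1) `cumulantSum P̂₀ H^{A_k(·−τ_k)}_{J_k+τ_k} t − cumulantSum P̂₀ H^{A_k(·−τ_k)}_{Γ̄₁(B_k)} t − idErr_k ≤ Σ_{□∈B_k}ℓ_k(□)`, and the ledger (O2)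
  `Σ_{k≤d}(err₅₁₁(k) + err₅₃₄(k) + idErr_k) + |I|·k₁e^{−k₂b_{d+1}²} ≤ |I|·errTerm S ρ₁ ρ₂ ρ₃ ρ₄ A b t`; `log_integral_ge_of_ineq47` (`Ineq47` in
  logarithmic form, with the integral's positivity).
* Counting along the chain (the `|I|`-extensivity inputs of (O2)): `card_corridorsBar_le` (`|Γ̄₁(B)| ≤ |B|·L^d`), `card_boxes_le`, `card_chain_le` (`|J_k| ≤ |J_0|`).

HONEST SCOPE / NOT HERE.  (O1) and (O2) are hypotheses; the per-box bounds are hypotheses (supplied elsewhere by `perBox_condField_appD`); `b*`, `S`,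
`ρ₁…ρ₄` are whatever makes (O2) true — NOT chosen here; (4.6) is the sequel (`…PavementChainUpper`).  `BasicLemmaPrinted` stays OPEN; count-neutral
for N08; nothing of [Balaban1985UV3] (41)/(47)/(5) is asserted; nothing about d = 4, the continuum, OS axioms, a mass gap or the Clay problem.
-/

noncomputable section

open Finset MeasureTheory
open scoped BigOperators

namespace Literature.MathematicalPhysics.QuantumFieldTheory.Balaban1983to89.B1Eq324BenfattoSect5CollectErrors

open _root_.MeasureTheory
open Literature.MathematicalPhysics.QuantumFieldTheory.Balaban1983to89.B1Eq324BenfattoLemma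
open Literature.MathematicalPhysics.QuantumFieldTheory.Balaban1983to89.B1Eq324BenfattoSect5Boxes
open Literature.MathematicalPhysics.QuantumFieldTheory.Balaban1983to89.B1Eq324BenfattoSect5Eq511
open Literature.MathematicalPhysics.QuantumFieldTheory.Balaban1983to89.B1Eq324BenfattoSect5Eq524
open Literature.MathematicalPhysics.QuantumFieldTheory.Balaban1983to89.B1Eq324BenfattoSect5Eq534
open Literature.MathematicalPhysics.QuantumFieldTheory.Balaban1983to89.B1Eq324BenfattoSect5Eq515
open Literature.MathematicalPhysics.QuantumFieldTheory.Balaban1983to89.B1Eq324BenfattoSect5Iteration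
open Literature.MathematicalPhysics.QuantumFieldTheory.Balaban1983to89.B1Eq324BenfattoSect5Termination
open Literature.MathematicalPhysics.QuantumFieldTheory.Balaban1983to89.B1Eq324BenfattoSect5PavementStep
open Literature.MathematicalPhysics.QuantumFieldTheory.Balaban1983to89.B1Eq324BenfattoSect5PavementChain
open Literature.MathematicalPhysics.QuantumFieldTheory.Balaban1983to89.B1Eq324BenfattoSpecialisation (coefSup_nonneg)

variable {d : ℕ}

section Ineq47

variable {α β : ℝ} {s D t : ℕ} {κ : ℝ} {L w v : ℕ} {γ : ℝ} {S ρ₁ ρ₂ ρ₃ ρ₄ : ℝ}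

/-- The bracket `Σ_{k≤t}ℰ^T_μ(H;k)/k!` only reads the observable `H` as a function: equal Hamiltonians have equal brackets.
[cite: BenfattoEtAl1978, (2.7) p.147, (4.7) p.152] -/
theorem cumulantSum_congr_hamiltonian (μ : Measure (B1Eq324BenfattoLemma.Site d → ℝ)) {H H' : (B1Eq324BenfattoLemma.Site d → ℝ) → ℝ}
    (h : ∀ z, H z = H' z) (t : ℕ) : cumulantSum μ H t = cumulantSum μ H' t := by
  have : H = H' := funext h
  rw [this]

/-- **(4.7) FOR ONE CHOICE OF EVERYTHING, FROM THE LOWER PAVEMENT CHAIN** — «Collecting all the errors made in this process (4.7) is proven» (p. 159) with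
the two remaining obligations DISPLAYED.  Data: `a` (the coefficient family of (4.7)) and a chain `(J_k, I_k, A_k, b_k, τ_k, B_k)_{k≤d+1}` starting at
`(J, I, A_0, b)` with `A_0` a clipped twin of `a` on `J` (`hH`: same Hamiltonians on the sub-regions of `J`; extension convention; global bound
`≤ A ≡ coefSup s D a J`), obeying the recursion of `…PavementChain.lowerPavementChain`, with per-box lower bounds (exponents `ℓ_k(□)`), suitably separated
displacements, and Appendix A's `(b̄, k₁, k₂)` at the terminal cut-off; PLUS (O1) per step `k ≤ d`:
`cumulantSum P̂₀ H^{A_k(·−τ_k)}_{J_k+τ_k} t − cumulantSum P̂₀ H^{A_k(·−τ_k)}_{Γ̄₁(B_k)} t − idErr_k ≤ Σ_{□∈B_k}ℓ_k(□)` (the identification of the extracted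
exponents, any losses `idErr_k`); PLUS (O2) `Σ_{k≤d}(err₅₁₁(k) + err₅₃₄(k) + idErr_k) + |I|·k₁e^{−k₂b_{d+1}²} ≤ |I|·errTerm S ρ₁ ρ₂ ρ₃ ρ₄ A b t` (the ledger).
THEN `Ineq47 d α β t D s ϰ S ρ₁ ρ₂ ρ₃ ρ₄ b I J a`: `exp([Σ_{k=1}^{t}ℰ̂₀^T(H_J;k)/k!] − |I|·S(…)) ≤ ∫Π_Δχ̂_Δ e^{H_J} dP̂₀` — by the chain, the telescope
`…PavementChain.cumulantSum_chain_telescope_of_eq_empty` (`J_{d+1} = ∅`) and monotonicity of `exp`.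
[cite: BenfattoEtAl1978, Lemma (4.7) p.152; §5 p.154, (5.35) p.159 «Collecting all the errors made in this process (4.7) is proven»] -/
theorem ineq47_of_chain (hα : 0 < α) (hβ : 0 < β) (hκ : 0 < κ) (hL : 0 < L) (hw : 1 ≤ w) (hv : v ≤ w) (hγ : γ ≤ 1)
    (a : Coef d) {Js Is Bs : ℕ → Finset (B1Eq324BenfattoLemma.Site d)} {as : ℕ → Coef d} {bs : ℕ → ℝ} {τ : ℕ → B1Eq324BenfattoLemma.Site d}
    (hH : ∀ R : Finset (B1Eq324BenfattoLemma.Site d), R ⊆ Js 0 → ∀ z, hamiltonian s D κ (as 0) R z = hamiltonian s D κ a R z)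
    (hsupp : CoefSupportedIn (as 0) (Js 0))
    (hA : ∀ (p : ℕ) (Δ : Fin p → B1Eq324BenfattoLemma.Site d) (nn : Fin p → ℕ), |as 0 p Δ nn| ≤ coefSup s D a (Js 0)) (hJI : Js 0 ⊆ Is 0)
    (hrecJ : ∀ k < d + 1, Js (k + 1) = (Js k).image (fun x => x + τ k) ∩ corridorsBar L w v (Bs k))
    (hrecI : ∀ k < d + 1, Is (k + 1) = (Is k).image fun x => x + τ k)
    (hreca : ∀ k < d + 1, as (k + 1) = restrictCoef (shiftCoef (as k) (-τ k)) (corridorsBar L w v (Bs k)))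
    (hrecb : ∀ k < d + 1, bs (k + 1) = γ * bs k) (hb : ∀ k < d + 1, 1 ≤ bs k)
    (hB : ∀ k < d + 1, ((Js k).image fun x => x + τ k).image (boxIndex L) ⊆ Bs k)
    (ℓ : ℕ → B1Eq324BenfattoLemma.Site d → ℝ)
    (hbox : ∀ k < d + 1, ∀ m ∈ Bs k, ∀ ξ : B1Eq324BenfattoLemma.Site d → ℝ,
      ξ ∈ smallFieldOn (corridors L w (Bs k) : Set (B1Eq324BenfattoLemma.Site d)) ((Is k).image fun x => x + τ k) (γ * bs k) →
      Real.exp (ℓ k m) * ∫ z in smallFieldOn (shrink L m w : Set (B1Eq324BenfattoLemma.Site d)) ((Is k).image fun x => x + τ k) (bs k),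
          Real.exp (psi1p s D κ (shiftCoef (as k) (-τ k)) L w v m z + psi2 s D κ (shiftCoef (as k) (-τ k)) L w m z)
            ∂condField d α β (corridors L w (Bs k)) ξ
        ≤ ∫ z in smallFieldOn (shrink L m w : Set (B1Eq324BenfattoLemma.Site d)) ((Is k).image fun x => x + τ k) (bs k),
          Real.exp (psiBox s D κ (shiftCoef (as k) (-τ k)) L w m z) ∂condField d α β (corridors L w (Bs k)) ξ)
    (hsep : ∀ j j' : Fin (d + 1), j ≠ j' → ∀ (i : Fin d) (q : ℤ),
      (2 * (2 * w + v : ℕ) : ℤ) ≤ |(-(∑ i' ∈ Finset.range ((j : ℕ) + 1), τ i')) i - (-(∑ i' ∈ Finset.range ((j' : ℕ) + 1), τ i')) i - q * L|)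
    {bbar k₁ k₂ : ℝ}
    (hAppA : ∀ c : ℝ, bbar < c → ∀ I' : Finset (B1Eq324BenfattoLemma.Site d), I'.Nonempty →
      Real.exp (-((I'.card : ℝ) * (k₁ * Real.exp (-(k₂ * c ^ 2))))) ≤ (P0 d α β).real (smallFieldSet I' c))
    (hI0 : (Is 0).Nonempty) (hbbar : bbar < bs (d + 1))
    (idErr : ℕ → ℝ)
    (hE : ∀ k < d + 1,
      cumulantSum (P0 d α β) (hamiltonian s D κ (shiftCoef (as k) (-τ k)) ((Js k).image fun x => x + τ k)) t
        - cumulantSum (P0 d α β) (hamiltonian s D κ (shiftCoef (as k) (-τ k)) (corridorsBar L w v (Bs k))) t - idErr k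
        ≤ ∑ m ∈ Bs k, ℓ k m)
    (hledger : ∑ k ∈ Finset.range (d + 1),
        (s1Const s D d κ * coefSup s D a (Js 0) * bs k ^ D * Real.exp (-(κ / 4 * w)) * (Js k).card
          + s1Const s D d κ * coefSup s D a (Js 0) * bs k ^ D *
            (Real.exp (-(κ / 4 * w)) * (corridorsBar L w v (Bs k)).card + Real.exp (-(κ / 4 * v)) * ((Bs k).card * (L : ℝ) ^ d))
          + idErr k)
        + (Is 0).card * (k₁ * Real.exp (-(k₂ * bs (d + 1) ^ 2)))
        ≤ (Is 0).card * errTerm S ρ₁ ρ₂ ρ₃ ρ₄ (coefSup s D a (Js 0)) (bs 0) t) :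
    Ineq47 d α β t D s κ S ρ₁ ρ₂ ρ₃ ρ₄ (bs 0) (Is 0) (Js 0) a := by
  unfold Ineq47
  have hA0 : 0 ≤ coefSup s D a (Js 0) := coefSup_nonneg s D a (Js 0)
  have hchain := lowerPavementChain_appendixA hα hβ hκ hL hw hv hγ hA0 hsupp hA hJI hrecJ hrecI hreca hrecb hb hB ℓ hbox hsep hAppA hI0
    hbbar (s := s) (D := D)
  have hJe : Js (d + 1) = ∅ := chain_eq_empty_of_sep hL hrecJ hsep
  have htel := cumulantSum_chain_telescope_of_eq_empty hα hβ hsupp hrecJ hreca hJe t (s := s) (D := D) (κ := κ)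
  -- the chain runs on the clipped family; the target reads `a`
  have hint : ∫ z, cutoffBoltzmann (hamiltonian s D κ (as 0) (Js 0)) (Is 0) (bs 0) z ∂P0 d α β =
      ∫ z, cutoffBoltzmann (hamiltonian s D κ a (Js 0)) (Is 0) (bs 0) z ∂P0 d α β := by
    have hfun : hamiltonian s D κ (as 0) (Js 0) = hamiltonian s D κ a (Js 0) := funext (hH (Js 0) subset_rfl)
    rw [hfun]
  have hcum : cumulantSum (P0 d α β) (hamiltonian s D κ (as 0) (Js 0)) t = cumulantSum (P0 d α β) (hamiltonian s D κ a (Js 0)) t :=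
    cumulantSum_congr_hamiltonian _ (hH (Js 0) subset_rfl) t
  rw [hint] at hchain
  rw [hcum] at htel
  refine le_trans ?_ hchain
  rw [Real.exp_le_exp]
  -- (O1) summed over the steps
  have hO1 : ∑ k ∈ Finset.range (d + 1),
      (cumulantSum (P0 d α β) (hamiltonian s D κ (shiftCoef (as k) (-τ k)) ((Js k).image fun x => x + τ k)) t
        - cumulantSum (P0 d α β) (hamiltonian s D κ (shiftCoef (as k) (-τ k)) (corridorsBar L w v (Bs k))) t - idErr k)
      ≤ ∑ k ∈ Finset.range (d + 1), ∑ m ∈ Bs k, ℓ k m :=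
    Finset.sum_le_sum fun k hk => hE k (Finset.mem_range.mp hk)
  rw [Finset.sum_sub_distrib, htel] at hO1
  -- bookkeeping: split the chain's exponent
  have hsplit : ∑ k ∈ Finset.range (d + 1),
      (-(s1Const s D d κ * coefSup s D a (Js 0) * bs k ^ D * Real.exp (-(κ / 4 * w)) * (Js k).card)
        - s1Const s D d κ * coefSup s D a (Js 0) * bs k ^ D *
          (Real.exp (-(κ / 4 * w)) * (corridorsBar L w v (Bs k)).card + Real.exp (-(κ / 4 * v)) * ((Bs k).card * (L : ℝ) ^ d))
        + ∑ m ∈ Bs k, ℓ k m)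
      = ∑ k ∈ Finset.range (d + 1), ∑ m ∈ Bs k, ℓ k m
        - ∑ k ∈ Finset.range (d + 1),
          (s1Const s D d κ * coefSup s D a (Js 0) * bs k ^ D * Real.exp (-(κ / 4 * w)) * (Js k).card
            + s1Const s D d κ * coefSup s D a (Js 0) * bs k ^ D *
              (Real.exp (-(κ / 4 * w)) * (corridorsBar L w v (Bs k)).card + Real.exp (-(κ / 4 * v)) * ((Bs k).card * (L : ℝ) ^ d))) := by
    rw [← Finset.sum_sub_distrib]
    refine Finset.sum_congr rfl fun k _ => ?_
    ring
  rw [hsplit]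
  have hsum3 : ∑ k ∈ Finset.range (d + 1),
      (s1Const s D d κ * coefSup s D a (Js 0) * bs k ^ D * Real.exp (-(κ / 4 * w)) * (Js k).card
        + s1Const s D d κ * coefSup s D a (Js 0) * bs k ^ D *
          (Real.exp (-(κ / 4 * w)) * (corridorsBar L w v (Bs k)).card + Real.exp (-(κ / 4 * v)) * ((Bs k).card * (L : ℝ) ^ d))
        + idErr k)
      = ∑ k ∈ Finset.range (d + 1),
          (s1Const s D d κ * coefSup s D a (Js 0) * bs k ^ D * Real.exp (-(κ / 4 * w)) * (Js k).card
            + s1Const s D d κ * coefSup s D a (Js 0) * bs k ^ D *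
              (Real.exp (-(κ / 4 * w)) * (corridorsBar L w v (Bs k)).card + Real.exp (-(κ / 4 * v)) * ((Bs k).card * (L : ℝ) ^ d)))
        + ∑ k ∈ Finset.range (d + 1), idErr k := by
    rw [← Finset.sum_add_distrib]
  rw [hsum3] at hledger
  linarith

/-- **Logarithmic form**: under the same hypotheses the (4.7)-integral is positive and
`[Σ_{k=1}^{t}ℰ̂₀^T(H_J;k)/k!] − |I|·S(…) ≤ log ∫Π_Δχ̂_Δ e^{H_J} dP̂₀`. [cite: BenfattoEtAl1978, Lemma (4.7) p.152, §5 p.159] -/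
theorem log_integral_ge_of_ineq47 {b : ℝ} {I J : Finset (B1Eq324BenfattoLemma.Site d)} {a : Coef d}
    (h : Ineq47 d α β t D s κ S ρ₁ ρ₂ ρ₃ ρ₄ b I J a) :
    0 < ∫ z, cutoffBoltzmann (hamiltonian s D κ a J) I b z ∂P0 d α β ∧
      cumulantSum (P0 d α β) (hamiltonian s D κ a J) t - (I.card : ℝ) * errTerm S ρ₁ ρ₂ ρ₃ ρ₄ (coefSup s D a J) b t
        ≤ Real.log (∫ z, cutoffBoltzmann (hamiltonian s D κ a J) I b z ∂P0 d α β) := by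
  unfold Ineq47 at h
  have hpos : 0 < ∫ z, cutoffBoltzmann (hamiltonian s D κ a J) I b z ∂P0 d α β := lt_of_lt_of_le (Real.exp_pos _) h
  exact ⟨hpos, (Real.le_log_iff_exp_le hpos).mpr h⟩

end Ineq47

/-! ## Counting along the chain (the `|I|`-extensivity inputs of the ledger (O2)) -/

section Counting

variable {L w v : ℕ}

/-- **`|Γ̄₁(B)| ≤ |B|·L^d`**: the network `Γ̄₁(B)` lies in the union of the tesserae of `B` (`…Sect5Eq534.corridorsBar_subset_biUnion_box`), each of `L^d`
sites (`…Sect5Eq535.card_le_of_subset_box`). [cite: BenfattoEtAl1978, (5.7)–(5.8) pp.154–155, (5.34) p.159] -/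
theorem card_corridorsBar_le (B : Finset (B1Eq324BenfattoLemma.Site d)) : (corridorsBar L w v B).card ≤ B.card * L ^ d := by
  calc (corridorsBar L w v B).card ≤ (B.biUnion fun m => box L m).card := Finset.card_le_card (corridorsBar_subset_biUnion_box L w v B)
    _ ≤ ∑ m ∈ B, (box L m).card := Finset.card_biUnion_le
    _ ≤ ∑ _m ∈ B, L ^ d := Finset.sum_le_sum fun m _ => Literature.MathematicalPhysics.QuantumFieldTheory.Balaban1983to89.B1Eq324BenfattoSect5Eq535.card_le_of_subset_box subset_rfl
    _ = B.card * L ^ d := by rw [Finset.sum_const, smul_eq_mul]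

/-- **The tesserae meeting a region are at most as many as its sites**: `|(J+τ).image boxIndex| ≤ |J|`. [cite: BenfattoEtAl1978, (5.7) p.154] -/
theorem card_boxes_le (J : Finset (B1Eq324BenfattoLemma.Site d)) (τ : B1Eq324BenfattoLemma.Site d) :
    ((J.image fun x => x + τ).image (boxIndex L)).card ≤ J.card :=
  Finset.card_image_le.trans Finset.card_image_le

/-- **The regions of the chain shrink**: along `J_{k+1} = (J_k + τ_k) ∩ Γ̄₁(B_k)`, `|J_k| ≤ |J_0|` for every `k ≤ n`.
[cite: BenfattoEtAl1978, §5 p.154 «eliminate the boxes ∩ J and repeat the procedure for the region J ∩ Γ₁»] -/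
theorem card_chain_le {Js Bs : ℕ → Finset (B1Eq324BenfattoLemma.Site d)} {τ : ℕ → B1Eq324BenfattoLemma.Site d} {n : ℕ}
    (hrecJ : ∀ k < n, Js (k + 1) = (Js k).image (fun x => x + τ k) ∩ corridorsBar L w v (Bs k)) :
    ∀ k ≤ n, (Js k).card ≤ (Js 0).card := by
  intro k
  induction k with
  | zero => exact fun _ => le_rfl
  | succ k ih =>
    intro hk
    have hk' : k < n := Nat.lt_of_succ_le hk
    rw [hrecJ k hk']
    exact (Finset.card_le_card Finset.inter_subset_left).trans (Finset.card_image_le.trans (ih hk'.le))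

end Counting

end Literature.MathematicalPhysics.QuantumFieldTheory.Balaban1983to89.B1Eq324BenfattoSect5CollectErrors

end
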